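import Summits.ValiantsHypothesis.ValiantsHypothesis.Theorems.DefinabilityGapGhostThree
import Summits.ValiantsHypothesis.ValiantsHypothesis.Theorems.DefinabilityGapPivotLive
import HarnessLib

/-!
# DefinabilityGap — the `m = 4` ghost family is independent, by a PIVOT CERTIFICATE (kernel)

Route `route-ValiantsHypothesis-DefinabilityGap`, residual crux `KIPlantedHitting` (item 23547),
rung `R_K1.1`, ROAD P.  The extremal family at `m = 4` (`q = 17`): both full parallel classes
`{(a,0,0)}`, `{(a,0,1)}` (`a ∈ 𝔽₁₇`) and the curve `(1,2,3)` — `35 = 2q + 1` curves, the target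
size of `R_K1.1`, a family on which every plain ranking certificate fails — carries a ONE-COLUMN
PIVOT CERTIFICATE `KIPivotCertificate 4 T 0 r` (`DefinabilityGapPivotCertificate`): pivot column
`s₀ = 0`, a pivot row `r c` per curve with pairwise distinct pivot cells, and for every curve an
explicit transversal through its pivot avoiding all gadget zeros (row `r c'` of every `c'`, off
column `0`).  The certificate was found by the lens-5 g7 instrument `pivcert.py` (local search,
7 moves) and is checked here by `decide` **in the kernel** on an explicit `ℕ`-model of the cells,
transported to the design exactly as in `DefinabilityGapGhostThree`; independence is then the
pivot rung `kiPer_algebraicIndependent_of_pivotCertificate`.  First kernel instance at `m = 4` of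
the `2q + 1` target, and the first end-to-end use of ROAD P's own certificate format
(instrument → table → kernel check → independence).
-/

noncomputable section

open Finset
open Literature.Computability.AlgebraicComplexity Literature.Computability.MetaComplexity
open Summit.ValiantsHypothesis.ValiantsHypothesis.Theorems.DefinabilityGapAffineRung
open Summit.ValiantsHypothesis.ValiantsHypothesis.Theorems.DefinabilityGapPivotCertificate
open Summit.ValiantsHypothesis.ValiantsHypothesis.Theorems.DefinabilityGapPivotLive
open Summit.ValiantsHypothesis.ValiantsHypothesis.Theorems.DefinabilityGapGhostThree (Curve
  cellEmb_fst_val cellEmb_snd_val)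

namespace Summit.ValiantsHypothesis.ValiantsHypothesis.Theorems.DefinabilityGapGhostFour

/-! ## `q(4) = 17` -/

/-- `q(4) = 17` (the least prime `≥ 17`). [this file] -/
theorem qOf_four : qOf 4 = 17 := by
  show leastPrimeGe (4 * 4 + 1) = 17
  unfold leastPrimeGe
  rw [Nat.find_eq_iff]
  exact ⟨⟨by norm_num, by norm_num⟩, fun n hn h => by omega⟩

/-! ## The explicit `ℕ`-model of the certificate -/

/-- The 35 curves `(c₀, c₁, c₂)` of the `m = 4` ghost family: the parallel classes `{(a,0,0)}`,
`{(a,0,1)}` (`a ∈ 𝔽₁₇`) and `(1,2,3)`. [this file] -/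
def fourCurves : List Curve :=
  [(0, 0, 0), (1, 0, 0), (2, 0, 0), (3, 0, 0), (4, 0, 0), (5, 0, 0), (6, 0, 0),
   (7, 0, 0), (8, 0, 0), (9, 0, 0), (10, 0, 0), (11, 0, 0), (12, 0, 0), (13, 0, 0),
   (14, 0, 0), (15, 0, 0), (16, 0, 0), (0, 0, 1), (1, 0, 1), (2, 0, 1), (3, 0, 1),
   (4, 0, 1), (5, 0, 1), (6, 0, 1), (7, 0, 1), (8, 0, 1), (9, 0, 1), (10, 0, 1),
   (11, 0, 1), (12, 0, 1), (13, 0, 1), (14, 0, 1), (15, 0, 1), (16, 0, 1), (1, 2, 3)]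

/-- The pivot ROW of each curve (pivot column `s₀ = 0`), found by the instrument. [this file] -/
def rowTab : List (Curve × Fin 4) :=
  [((0, 0, 0), 1), ((1, 0, 0), 0), ((2, 0, 0), 2), ((3, 0, 0), 1), ((4, 0, 0), 1),
   ((5, 0, 0), 3), ((6, 0, 0), 3), ((7, 0, 0), 3), ((8, 0, 0), 1), ((9, 0, 0), 0),
   ((10, 0, 0), 3), ((11, 0, 0), 0), ((12, 0, 0), 3), ((13, 0, 0), 3), ((14, 0, 0), 0),
   ((15, 0, 0), 3), ((16, 0, 0), 2), ((0, 0, 1), 0), ((1, 0, 1), 2), ((2, 0, 1), 0),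
   ((3, 0, 1), 0), ((4, 0, 1), 0), ((5, 0, 1), 0), ((6, 0, 1), 3), ((7, 0, 1), 0),
   ((8, 0, 1), 1), ((9, 0, 1), 3), ((10, 0, 1), 0), ((11, 0, 1), 1), ((12, 0, 1), 3),
   ((13, 0, 1), 3), ((14, 0, 1), 1), ((15, 0, 1), 2), ((16, 0, 1), 1), ((1, 2, 3), 1)]

/-- The transversal of each curve through its pivot avoiding the gadget zeros: column `j ↦` row
`σ j` (so `σ 0 =` the pivot row), found by the instrument. [this file] -/
def sigTab : List (Curve × (Fin 4 → Fin 4)) :=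
  [((0, 0, 0), ![1, 3, 2, 0]), ((1, 0, 0), ![0, 3, 2, 1]), ((2, 0, 0), ![2, 3, 0, 1]),
   ((3, 0, 0), ![1, 3, 2, 0]), ((4, 0, 0), ![1, 3, 2, 0]), ((5, 0, 0), ![3, 2, 1, 0]),
   ((6, 0, 0), ![3, 2, 1, 0]), ((7, 0, 0), ![3, 2, 1, 0]), ((8, 0, 0), ![1, 2, 3, 0]),
   ((9, 0, 0), ![0, 3, 1, 2]), ((10, 0, 0), ![3, 2, 0, 1]), ((11, 0, 0), ![0, 1, 3, 2]),
   ((12, 0, 0), ![3, 1, 0, 2]), ((13, 0, 0), ![3, 2, 0, 1]), ((14, 0, 0), ![0, 3, 1, 2]),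
   ((15, 0, 0), ![3, 2, 1, 0]), ((16, 0, 0), ![2, 3, 0, 1]), ((0, 0, 1), ![0, 3, 2, 1]),
   ((1, 0, 1), ![2, 3, 0, 1]), ((2, 0, 1), ![0, 1, 3, 2]), ((3, 0, 1), ![0, 3, 1, 2]),
   ((4, 0, 1), ![0, 3, 1, 2]), ((5, 0, 1), ![0, 3, 1, 2]), ((6, 0, 1), ![3, 1, 2, 0]),
   ((7, 0, 1), ![0, 1, 3, 2]), ((8, 0, 1), ![1, 2, 3, 0]), ((9, 0, 1), ![3, 2, 0, 1]),
   ((10, 0, 1), ![0, 3, 1, 2]), ((11, 0, 1), ![1, 0, 3, 2]), ((12, 0, 1), ![3, 2, 0, 1]),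
   ((13, 0, 1), ![3, 2, 1, 0]), ((14, 0, 1), ![1, 0, 2, 3]), ((15, 0, 1), ![2, 3, 0, 1]),
   ((16, 0, 1), ![1, 0, 3, 2]), ((1, 2, 3), ![1, 2, 0, 3])]

/-- Model pivot row of a curve. [this file] -/
def mrow (t : Curve) : Fin 4 := (rowTab.lookup t).getD 0

/-- Model transversal of a curve. [this file] -/
def msig (t : Curve) : Fin 4 → Fin 4 := (sigTab.lookup t).getD fun _ => 0

/-- Model cell of curve `t` at position `p = (i, j)`: `(k, (t₀ + t₁ k + t₂ k²) mod 17)`,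
`k = j + 4 i`. [this file] -/
def mcell (t : Curve) (p : Fin 4 × Fin 4) : ℕ × ℕ :=
  ((p.2 : ℕ) + 4 * (p.1 : ℕ),
    (t.1 + t.2.1 * ((p.2 : ℕ) + 4 * (p.1 : ℕ)) + t.2.2 * ((p.2 : ℕ) + 4 * (p.1 : ℕ)) ^ 2) % 17)

/-! ## The finite checks (by `decide` in the kernel) -/

/-- Data bounds. [this file] -/
theorem fourCurves_lt : ∀ t ∈ fourCurves, t.1 < 17 ∧ t.2.1 < 17 ∧ t.2.2 < 17 := by decide

/-- (i) of the certificate, model side: the pivot cells `(mrow t, 0)` are pairwise distinct.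
[this file] -/
theorem model_inj : ∀ t ∈ fourCurves, ∀ t' ∈ fourCurves, t ≠ t' →
    mcell t (mrow t, 0) ≠ mcell t' (mrow t', 0) := by
  decide +kernel

/-- The model transversals are permutations through the pivots. [this file] -/
theorem model_perm : ∀ t ∈ fourCurves, Function.Injective (msig t) ∧ msig t 0 = mrow t := by
  decide +kernel

/-- (ii) of the certificate, model side: off column `0`, the transversal cell of `t` in column `i`
is not the row-`(msig t i)` gadget cell of another curve `t'` with pivot row `msig t i`.
[this file] -/
theorem model_avoid : ∀ t ∈ fourCurves, ∀ i : Fin 4, i ≠ 0 → ∀ t' ∈ fourCurves, t' ≠ t →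
    mrow t' = msig t i → mcell t' (msig t i, i) ≠ mcell t (msig t i, i) := by
  decide +kernel

/-! ## Transport to the design -/

/-- `n mod q(4)` as an element of `Fin q(4)`. [this file] -/
def natQ (n : ℕ) : Fin (qOf 4) := ⟨n % qOf 4, Nat.mod_lt _ (qOf_spec 4).2.pos⟩

/-- `(natQ n : ℕ) = n` for `n < 17`. [this file] -/
theorem natQ_val {n : ℕ} (hn : n < 17) : (natQ n : ℕ) = n := by
  show n % qOf 4 = n
  rw [qOf_four]
  exact Nat.mod_eq_of_lt hn

/-- The curve of the design named by the data `t`. [this file] -/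
def curveOf (t : Curve) : Fin 3 → Fin (qOf 4)
  | ⟨0, _⟩ => natQ t.1
  | ⟨1, _⟩ => natQ t.2.1
  | _ => natQ t.2.2

/-- The pair of coordinates of a seed cell, as naturals. [this file] -/
def valPair (x : Fin (qOf 4) × Fin (qOf 4)) : ℕ × ℕ := ((x.1 : ℕ), (x.2 : ℕ))

/-- The data triple of a curve. [this file] -/
def tripleOf (c : Fin 3 → Fin (qOf 4)) : Curve := ((c 0 : ℕ), (c 1 : ℕ), (c 2 : ℕ))

/-- **The ghost family at `m = 4`.** [this file] -/
def fourFamily : Finset (Fin 3 → Fin (qOf 4)) := fourCurves.toFinset.image curveOf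

/-- The pivot row of a curve of the design. [this file] -/
def rowOf (c : Fin 3 → Fin (qOf 4)) : Fin 4 := mrow (tripleOf c)

/-- `valPair` is injective. [this file] -/
theorem valPair_injective : Function.Injective valPair := by
  intro x y h
  simp only [valPair, Prod.mk.injEq] at h
  exact Prod.ext (Fin.ext h.1) (Fin.ext h.2)

/-- Round trip on reduced data. [this file] -/
theorem tripleOf_curveOf {t : Curve} (ht : t.1 < 17 ∧ t.2.1 < 17 ∧ t.2.2 < 17) :
    tripleOf (curveOf t) = t := by
  obtain ⟨a, b, c⟩ := t
  show (((natQ a : Fin (qOf 4)) : ℕ), ((natQ b : Fin (qOf 4)) : ℕ), ((natQ c : Fin (qOf 4)) : ℕ)) =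
    (a, b, c)
  rw [natQ_val ht.1, natQ_val ht.2.1, natQ_val ht.2.2]

/-- **Cells of a listed curve are computed by the model.** [this file] -/
theorem valPair_cellEmb (t : Curve) (ht : t.1 < 17 ∧ t.2.1 < 17 ∧ t.2.2 < 17)
    (p : Fin 4 × Fin 4) : valPair (cellEmb 4 (curveOf t) p) = mcell t p := by
  have h0 : ((curveOf t 0 : Fin (qOf 4)) : ℕ) = t.1 := natQ_val ht.1
  have h1 : ((curveOf t 1 : Fin (qOf 4)) : ℕ) = t.2.1 := natQ_val ht.2.1
  have h2 : ((curveOf t 2 : Fin (qOf 4)) : ℕ) = t.2.2 := natQ_val ht.2.2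
  refine Prod.ext ?_ ?_
  · exact cellEmb_fst_val 4 (curveOf t) p
  · show ((cellEmb 4 (curveOf t) p).2 : ℕ) = _
    rw [cellEmb_snd_val, h0, h1, h2, qOf_four]
    rfl

/-- Members of the family are listed curves. [this file] -/
theorem exists_of_mem_fourFamily {c : Fin 3 → Fin (qOf 4)} (hc : c ∈ fourFamily) :
    ∃ t ∈ fourCurves, curveOf t = c := by
  simpa only [fourFamily, Finset.mem_image, List.mem_toFinset] using hc

/-- The family has `35 = 2 q(4) + 1` members. [this file] -/
theorem fourFamily_card : fourFamily.card = 2 * qOf 4 + 1 := by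
  have hc : fourFamily.card = 35 := by
    rw [fourFamily, Finset.card_image_of_injOn]
    · decide
    · intro t ht t' ht' h
      have h1 := congrArg tripleOf h
      rwa [tripleOf_curveOf (fourCurves_lt t (by simpa using ht)),
        tripleOf_curveOf (fourCurves_lt t' (by simpa using ht'))] at h1
  have hq := qOf_four
  omega

/-! ## The certificate and the theorem -/

/-- **The `m = 4` ghost family carries a one-column pivot certificate** (pivot column `0`).
[this file] -/
theorem fourFamily_pivotCertificate : KIPivotCertificate 4 fourFamily 0 rowOf := by
  refine ⟨?_, ?_⟩
  · intro c hc c' hc' heq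
    obtain ⟨t, ht, rfl⟩ := exists_of_mem_fourFamily hc
    obtain ⟨t', ht', rfl⟩ := exists_of_mem_fourFamily hc'
    have htl := fourCurves_lt t ht
    have htl' := fourCurves_lt t' ht'
    by_contra hne
    have hne' : t ≠ t' := fun h => hne (by rw [h])
    refine model_inj t ht t' ht' hne' ?_
    have e := congrArg valPair heq
    rw [valPair_cellEmb t htl, valPair_cellEmb t' htl'] at e
    simpa [rowOf, tripleOf_curveOf htl, tripleOf_curveOf htl'] using e
  · intro c hc
    obtain ⟨t, ht, rfl⟩ := exists_of_mem_fourFamily hc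
    have htl := fourCurves_lt t ht
    obtain ⟨hinj, h0⟩ := model_perm t ht
    have hrow : rowOf (curveOf t) = mrow t := by rw [rowOf, tripleOf_curveOf htl]
    refine ⟨Equiv.ofBijective (msig t) (Finite.injective_iff_bijective.mp hinj), fun i => ?_, ?_⟩
    · rw [Equiv.ofBijective_apply]
      by_cases hi : i = 0
      · subst hi
        rw [h0, ← hrow]
        exact pivot_not_mem_pivotZeros fourFamily 0 rowOf (curveOf t)
      · intro hmem
        have hne : msig t i ≠ rowOf (curveOf t) := by
          rw [hrow, ← h0]
          exact fun h => hi (hinj h)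
        obtain ⟨c', hc', hc'ne, hr, he⟩ := exists_of_mem_pivotZeros hne hmem
        obtain ⟨t', ht', rfl⟩ := exists_of_mem_fourFamily hc'
        have htl' := fourCurves_lt t' ht'
        have hne' : t' ≠ t := fun h => hc'ne (by rw [h])
        have hr' : mrow t' = msig t i := by rw [← hr, rowOf, tripleOf_curveOf htl']
        refine model_avoid t ht i hi t' ht' hne' hr' ?_
        have e := congrArg valPair he
        rwa [valPair_cellEmb t' htl', valPair_cellEmb t htl] at e
    · rw [Equiv.ofBijective_apply, h0, ← hrow]

/-- **The ghost family at `m = 4` is algebraically independent**: the `35 = 2q + 1` permanents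
`per₄(y|S_c)`, `c ∈ {(a,0,0)} ∪ {(a,0,1)} ∪ {(1,2,3)}` over `𝔽₁₇`, planted along the
quadratic-curve design, are algebraically independent over `ℂ` — by the pivot rung applied to the
kernel-checked pivot certificate. [this file] -/
theorem fourFamily_algebraicIndependent :
    AlgebraicIndependent ℂ (fun c : fourFamily => kiPer 4 (c : Fin 3 → Fin (qOf 4))) :=
  kiPer_algebraicIndependent_of_pivotCertificate 4 fourFamily 0 rowOf fourFamily_pivotCertificate

end Summit.ValiantsHypothesis.ValiantsHypothesis.Theorems.DefinabilityGapGhostFour
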